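import Summits.RiemannHypothesis.RiemannHypothesis.Theorems.LiTailLaguerreLawProof
import HarnessLib

/-!
# RiemannHypothesis / LiTailLaguerre — the ECHO STAIRCASE is a theorem (RH-FREE PROOF-OF-DATA)

RH-FREE [rh-li-eng-4].  Cell `pub/rh-li`, theory round 7.  With the rung leaf «Li TAIL–LAGUERRE LAW» PROVED
(`liZeroTailLaguerre_proof`, rh-li-prover g5; every binder of route `Theses/LiTailLaguerre.lean` CLOSED·proved), the
composition `liZeroWindowLaguerre_of_laguerre` (`Theorems/LiTailLaguerreCompanions.lean`) gives the column's structure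
statement for the oscillatory part of `λ_n` UNCONDITIONALLY, in Laguerre form:

* `liZeroWindowLaguerre` — for all admissible cuts `0 < c₁ ≤ c₂` (no prime power `m` with `log m = 1/c₁²` or `= 1/c₂²`)
  there is `C` with, for all `n ≥ 2`,
  `|liZeroTraceWindow n (c₁√n) (c₂√n) − liSmoothTraceWindow n (c₁√n) (c₂√n)
      − (Σ_{2 ≤ m ≤ e^{1/c₁²}} liCoffeyTerm m n − Σ_{2 ≤ m ≤ e^{1/c₂²}} liCoffeyTerm m n)| ≤ C log² n`:
  THE ZEROS OF HEIGHT `(c₁√n, c₂√n]`, Li-weighted (whatever their real parts) and compared with their Riemann–von Mangoldt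
  mean, CARRY EXACTLY THE BOMBIERI–LAGARIAS/COFFEY TERMS `(Λ(m)/m) L¹_{n−1}(log m)` OF THE PRIME POWERS
  `e^{1/c₂²} < m ≤ e^{1/c₁²}` — the echo staircase with steps at `c_m = (log m)^{−1/2}` (DATA: ECHO-X kit j252784, DATA.md §N;
  lineage F / Z-echo §F/§M; the prime-side staircase §N.13);
* `liZeroWindowEchoes_of_fejer` — PART D's T3e `LiZeroWindowEchoes` (main terms = the Fejér chirps `−E_m(n)`) now waits ONLY
  on the weak Fejér law `∀ m ≥ 2, ∃ C, ∀ n ≥ 1, |liCoffeyTerm m n + liPrimeEcho m n| ≤ C` (rh-li-eng g6's target);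
* `abs_liCoffeyTerm_two_add_liPrimeEcho_le` — for `m = 2` that law holds in the weak form `O(log² n)` already, forced by the two
  PROVED leaves (round 6 window law + round 7 tail law).

Nothing here bears on the truth of RH: RH-free theorems about the explicit-formula bookkeeping of the zeros in a window.
-/

noncomputable section

-- D-0017: `Summit.<S>.<S>.…` is the designed namespace of a single-problem summit.
set_option linter.dupNamespace false

open scoped ArithmeticFunction.vonMangoldt

namespace Summit.RiemannHypothesis.RiemannHypothesis.Theorems.LiTheory

/-- **THE ECHO STAIRCASE (Laguerre form) — RH-FREE PROOF-OF-DATA theorem.**  Every window `(c₁√n, c₂√n]` of zeros hears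
exactly the Coffey–Laguerre terms of the prime powers `e^{1/c₂²} < m ≤ e^{1/c₁²}`, up to `O(log² n)`. -/
theorem liZeroWindowLaguerre :
    ∀ c₁ c₂ : ℝ, 0 < c₁ → c₁ ≤ c₂ →
      (∀ m : ℕ, 2 ≤ m → (Λ m : ℝ) ≠ 0 → Real.log m ≠ 1 / c₁ ^ 2) →
      (∀ m : ℕ, 2 ≤ m → (Λ m : ℝ) ≠ 0 → Real.log m ≠ 1 / c₂ ^ 2) →
      ∃ C : ℝ, ∀ n : ℕ, 2 ≤ n →
        |liZeroTraceWindow n (c₁ * Real.sqrt n) (c₂ * Real.sqrt n)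
            - liSmoothTraceWindow n (c₁ * Real.sqrt n) (c₂ * Real.sqrt n)
            - (∑ m ∈ Finset.Icc 2 ⌊Real.exp (1 / c₁ ^ 2)⌋₊, liCoffeyTerm m n
                - ∑ m ∈ Finset.Icc 2 ⌊Real.exp (1 / c₂ ^ 2)⌋₊, liCoffeyTerm m n)|
          ≤ C * Real.log n ^ 2 :=
  liZeroWindowLaguerre_of_laguerre liZeroTailLaguerre_proof

/-- **T3e from the weak Fejér law alone (RH-FREE):** `(∀ m ≥ 2, ∃ C, ∀ n ≥ 1, |liCoffeyTerm m n + liPrimeEcho m n| ≤ C) →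
LiZeroWindowEchoes` (the leaf hypothesis of `liZeroWindowEchoes_of_laguerre_of_fejer` discharged by
`liZeroTailLaguerre_proof`). -/
theorem liZeroWindowEchoes_of_fejer
    (hF : ∀ m : ℕ, 2 ≤ m → ∃ C : ℝ, ∀ n : ℕ, 1 ≤ n → |liCoffeyTerm m n + liPrimeEcho m n| ≤ C) :
    LiZeroWindowEchoes :=
  liZeroWindowEchoes_of_laguerre_of_fejer liZeroTailLaguerre_proof hF

/-- **Weak Fejér law for `m = 2`, forced by the two PROVED leaves (RH-FREE):**
`|liCoffeyTerm 2 n + liPrimeEcho 2 n| ≤ C log² n` for all `n ≥ 2`. -/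
theorem abs_liCoffeyTerm_two_add_liPrimeEcho_le :
    ∃ C : ℝ, ∀ n : ℕ, 2 ≤ n → |liCoffeyTerm 2 n + liPrimeEcho 2 n| ≤ C * Real.log n ^ 2 :=
  abs_liCoffeyTerm_two_add_liPrimeEcho_le_of_laguerre liZeroTailLaguerre_proof

end Summit.RiemannHypothesis.RiemannHypothesis.Theorems.LiTheory

end
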